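import Mathlib
import Literature.MathematicalPhysics.StatisticalMechanics.BarlowStacking
import Summits.AtomisticToContinuum.Crystallization.Theorems.BraggSlacknessRigidityHcpDiffractionRigidityTemplateLatticeSplitAux1

/-!
# Template lattices are split — Aux file 3: the rational Gram pencil of a template lattice
# (crux `HcpDiffractionRigidity`, item `stmt-AtomisticToContinuum-13166`,
# stub `stub_templateLatticeSplit`, B2c₁ᵦ)

For the hcp template with `t = h²/a² ∉ ℚ`, every squared template distance is
`a² (I² + IJ + J²)/9 + h² m²` (`hcp_dist_sq_decomp`), and the pair (in-layer part, `m²`) is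
determined by the length (`rat_coeff_unique`).  Hence on a `ℤ`-module `N ⊆ ℝ³` all of whose
vectors have template lengths the Euclidean form splits, by polarisation, as
`⟨z, z'⟩ = a² A(z,z') + h² H(z,z')` with well-defined symmetric biadditive `ℚ`-valued forms
`A, H`; the diagonal values of `A` are in-layer values `(I² + IJ + J²)/9` and those of `H` are
perfect squares `m²`, so `H = λ ⊗ λ` for an additive layer index `λ : N →+ ℤ` (Aux file 1).
This is `exists_forms`; registered helper stub `stub_templateLatticeSplit_forms`.
All `[folklore]`.
-/

noncomputable section

namespace Summit.AtomisticToContinuum.Crystallization.Theorems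

namespace HcpRigiditySplit

open scoped BigOperators Real RealInnerProductSpace
open Literature.MathematicalPhysics.StatisticalMechanics


/-! ## Arithmetic of template distances for `h² / a² ∉ ℚ` -/

/-- **Uniqueness of the `(a², h²)`-decomposition.** If `h²` is not a rational multiple of `a²`
(`a ≠ 0`), then `r₁ a² + s₁ h² = r₂ a² + s₂ h²` with rational `rᵢ, sᵢ` forces `r₁ = r₂` and
`s₁ = s₂`. [folklore] -/
theorem rat_coeff_unique {a h : ℝ} (ha : a ≠ 0) (hq : ¬ ∃ q : ℚ, h ^ 2 = (q : ℝ) * a ^ 2)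
    {r₁ s₁ r₂ s₂ : ℚ} (heq : (r₁ : ℝ) * a ^ 2 + s₁ * h ^ 2 = r₂ * a ^ 2 + s₂ * h ^ 2) :
    r₁ = r₂ ∧ s₁ = s₂ := by
  by_cases hs : s₁ = s₂
  · subst hs
    refine ⟨?_, rfl⟩
    have ha2 : a ^ 2 ≠ 0 := pow_ne_zero 2 ha
    have h1 : ((r₁ : ℝ) - r₂) * a ^ 2 = 0 := by linear_combination heq
    have h2 : (r₁ : ℝ) - r₂ = 0 := (mul_eq_zero.1 h1).resolve_right ha2
    exact_mod_cast sub_eq_zero.1 h2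
  · exfalso
    apply hq
    refine ⟨(r₂ - r₁) / (s₁ - s₂), ?_⟩
    have hs' : (s₁ : ℝ) - s₂ ≠ 0 := by exact_mod_cast sub_ne_zero.2 hs
    push_cast
    field_simp
    linear_combination heq

/-- **Template distances, incommensurate bookkeeping.** Every squared distance of the hcp template
is `a² (I² + IJ + J²) / 9 + h² m²` with integers `I ≡ J (mod 3)` (in-layer displacement
`(I u + J v)/3`) and `m` (layer difference), and the lateral class is tied to the parity of `m`:
`3 ∣ I ↔ m` even (`A` over `A` for even, `A` over `B` for odd layer differences). [folklore] -/
theorem hcp_dist_sq_decomp {a h : ℝ} (ha : a ≠ 0) (hh : h ≠ 0) {x y : EuclideanSpace ℝ (Fin 3)}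
    (hx : x ∈ (hcpPeriodicConfiguration ha hh).points)
    (hy : y ∈ (hcpPeriodicConfiguration ha hh).points) :
    ∃ I J m : ℤ, dist x y ^ 2 = a ^ 2 * (((I : ℝ) ^ 2 + I * J + J ^ 2) / 9) + h ^ 2 * (m : ℝ) ^ 2 ∧
      I ≡ J [ZMOD 3] ∧ ((3 : ℤ) ∣ I ↔ Even m) := by
  rw [hcpPeriodicConfiguration_points] at hx hy
  obtain ⟨k, i, j, rfl⟩ := mem_barlowStacking_iff.1 hx
  obtain ⟨k', i', j', rfl⟩ := mem_barlowStacking_iff.1 hy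
  refine ⟨3 * (i - i') + (haggLabel alternatingHagg k - haggLabel alternatingHagg k'),
    3 * (j - j') + (haggLabel alternatingHagg k - haggLabel alternatingHagg k'), k - k', ?_, ?_, ?_⟩
  · rw [dist_barlowPos_sq]
    have h3 : (√3 : ℝ) ^ 2 = 3 := Real.sq_sqrt (by norm_num)
    push_cast
    linear_combination (a ^ 2 * (((j : ℝ) - j') +
      ((haggLabel alternatingHagg k : ℝ) - haggLabel alternatingHagg k') / 3) ^ 2 / 4) * h3
  · exact Int.modEq_iff_dvd.2 ⟨(j - j') - (i - i'), by ring⟩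
  · rw [haggLabel_alternating, haggLabel_alternating]
    simp only [Int.even_iff]
    split_ifs <;> omega

/-- Template lengths of the vectors of `N`, in the `(I, J, m)` bookkeeping. [folklore] -/
theorem normSq_decomp_of_template {a h : ℝ} (ha : a ≠ 0) (hh : h ≠ 0)
    {N : Submodule ℤ (EuclideanSpace ℝ (Fin 3))}
    (hN : ∀ z ∈ N, ∃ a' ∈ (hcpPeriodicConfiguration ha hh).points,
      ∃ b' ∈ (hcpPeriodicConfiguration ha hh).points, ‖z‖ = dist a' b') :
    ∀ z ∈ N, ∃ I J m : ℤ,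
      ‖z‖ ^ 2 = a ^ 2 * (((I : ℝ) ^ 2 + I * J + J ^ 2) / 9) + h ^ 2 * (m : ℝ) ^ 2 := by
  intro z hz
  obtain ⟨a', ha', b', hb', hzab⟩ := hN z hz
  obtain ⟨I, J, m, hd, -, -⟩ := hcp_dist_sq_decomp ha hh ha' hb'
  exact ⟨I, J, m, by rw [hzab, hd]⟩

/-! ## The rational Gram pencil -/

/-- **Polarisation.** If all vectors of a `ℤ`-module `N ⊆ ℝ³` have squared norms in
`a² ℚ + h² ℚ` (template bookkeeping), then so do all inner products:
`⟨z, z'⟩ = (|z + z'|² − |z|² − |z'|²)/2`. [folklore] -/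
theorem exists_inner_decomp {a h : ℝ} {N : Submodule ℤ (EuclideanSpace ℝ (Fin 3))}
    (hN : ∀ z ∈ N, ∃ I J m : ℤ,
      ‖z‖ ^ 2 = a ^ 2 * (((I : ℝ) ^ 2 + I * J + J ^ 2) / 9) + h ^ 2 * (m : ℝ) ^ 2)
    (z z' : N) : ∃ p : ℚ × ℚ,
      ⟪(z : EuclideanSpace ℝ (Fin 3)), z'⟫ = (p.1 : ℝ) * a ^ 2 + (p.2 : ℝ) * h ^ 2 := by
  obtain ⟨I₁, J₁, m₁, h₁⟩ := hN _ (z + z').2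
  obtain ⟨I₂, J₂, m₂, h₂⟩ := hN _ z.2
  obtain ⟨I₃, J₃, m₃, h₃⟩ := hN _ z'.2
  refine ⟨⟨((I₁ ^ 2 + I₁ * J₁ + J₁ ^ 2) - (I₂ ^ 2 + I₂ * J₂ + J₂ ^ 2) -
    (I₃ ^ 2 + I₃ * J₃ + J₃ ^ 2)) / 18, (m₁ ^ 2 - m₂ ^ 2 - m₃ ^ 2) / 2⟩, ?_⟩
  have key : ⟪(z : EuclideanSpace ℝ (Fin 3)), z'⟫ =
      (‖((z + z' : N) : EuclideanSpace ℝ (Fin 3))‖ ^ 2 - ‖(z : EuclideanSpace ℝ (Fin 3))‖ ^ 2 -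
        ‖(z' : EuclideanSpace ℝ (Fin 3))‖ ^ 2) / 2 := by
    rw [Submodule.coe_add, norm_add_sq_real]; ring
  rw [key, h₁, h₂, h₃]
  push_cast
  ring

/-- **The rational Gram pencil of a template lattice.** Let `h²/a² ∉ ℚ` and let `N ⊆ ℝ³` be a
`ℤ`-module all of whose vectors have squared norms `a² (I² + IJ + J²)/9 + h² m²`.  Then there are a
symmetric biadditive form `A : N → N → ℚ` and an additive "layer index" `λ : N →+ ℤ` with
`⟨z, z'⟩ = a² A(z,z') + h² λ(z) λ(z')` for all `z, z' ∈ N`, and every diagonal value `A(z,z)` is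
an in-layer template value `(I² + IJ + J²)/9`.  (The coefficients are well defined by
`rat_coeff_unique`, biadditive and symmetric by uniqueness, the `h²`-part has square diagonal
`m²` and is therefore `λ ⊗ λ` by `exists_eq_mul_of_forall_sq`.) [folklore] -/
theorem exists_forms {a h : ℝ} (ha : a ≠ 0) (hq : ¬ ∃ q : ℚ, h ^ 2 = (q : ℝ) * a ^ 2)
    {N : Submodule ℤ (EuclideanSpace ℝ (Fin 3))}
    (hN : ∀ z ∈ N, ∃ I J m : ℤ,
      ‖z‖ ^ 2 = a ^ 2 * (((I : ℝ) ^ 2 + I * J + J ^ 2) / 9) + h ^ 2 * (m : ℝ) ^ 2) :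
    ∃ (A : N →+ N →+ ℚ) (lam : N →+ ℤ), (∀ z z' : N, A z z' = A z' z) ∧
      (∀ z z' : N, ⟪(z : EuclideanSpace ℝ (Fin 3)), z'⟫ =
        a ^ 2 * ((A z z' : ℚ) : ℝ) + h ^ 2 * ((lam z : ℤ) : ℝ) * ((lam z' : ℤ) : ℝ)) ∧
      (∀ z : N, ∃ I J : ℤ, A z z = ((I : ℚ) ^ 2 + I * J + J ^ 2) / 9) := by
  choose c hc using exists_inner_decomp hN
  -- uniqueness of the coefficients and its consequences
  have huniq : ∀ (z z' : N) (r s : ℚ),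
      ⟪(z : EuclideanSpace ℝ (Fin 3)), z'⟫ = (r : ℝ) * a ^ 2 + (s : ℝ) * h ^ 2 →
        c z z' = (r, s) := by
    intro z z' r s h1
    have h2 := rat_coeff_unique ha hq ((hc z z').symm.trans h1)
    exact Prod.ext h2.1 h2.2
  have hsymm : ∀ z z', c z z' = c z' z := fun z z' =>
    huniq _ _ _ _ (by rw [real_inner_comm]; exact hc z' z)
  have hadd : ∀ z z₁ z₂, c z (z₁ + z₂) = c z z₁ + c z z₂ := by
    intro z z₁ z₂
    apply huniq
    rw [Submodule.coe_add, inner_add_right, hc, hc]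
    push_cast
    ring
  have hadd' : ∀ z₁ z₂ z, c (z₁ + z₂) z = c z₁ z + c z₂ z := by
    intro z₁ z₂ z
    rw [hsymm, hadd, hsymm z, hsymm z]
  -- the two forms
  let A : N →+ N →+ ℚ := AddMonoidHom.mk'
    (fun z => AddMonoidHom.mk' (fun z' => (c z z').1) fun z₁ z₂ => by
      simp only [hadd, Prod.fst_add])
    fun z₁ z₂ => by
      ext z'
      simp only [AddMonoidHom.mk'_apply, AddMonoidHom.add_apply, hadd', Prod.fst_add]
  let H : N →+ N →+ ℚ := AddMonoidHom.mk'
    (fun z => AddMonoidHom.mk' (fun z' => (c z z').2) fun z₁ z₂ => by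
      simp only [hadd, Prod.snd_add])
    fun z₁ z₂ => by
      ext z'
      simp only [AddMonoidHom.mk'_apply, AddMonoidHom.add_apply, hadd', Prod.snd_add]
  have hA : ∀ z z', A z z' = (c z z').1 := fun _ _ => rfl
  have hH : ∀ z z', H z z' = (c z z').2 := fun _ _ => rfl
  -- diagonal values
  have hdiag : ∀ z : N, ∃ I J m : ℤ,
      A z z = ((I : ℚ) ^ 2 + I * J + J ^ 2) / 9 ∧ H z z = (m : ℚ) ^ 2 := by
    intro z
    obtain ⟨I, J, m, hz⟩ := hN _ z.2
    refine ⟨I, J, m, ?_⟩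
    have h1 := huniq z z (((I : ℚ) ^ 2 + I * J + J ^ 2) / 9) ((m : ℚ) ^ 2)
      (by rw [real_inner_self_eq_norm_sq, hz]; push_cast; ring)
    rw [hA, hH, h1]
    exact ⟨rfl, rfl⟩
  have hsq : ∀ z : N, ∃ m : ℤ, H z z = (m : ℚ) ^ 2 := by
    intro z
    obtain ⟨-, -, m, -, hm⟩ := hdiag z
    exact ⟨m, hm⟩
  obtain ⟨lam, hlam⟩ :=
    exists_eq_mul_of_forall_sq H (fun x y => by rw [hH, hH, hsymm]) hsq
  refine ⟨A, lam, fun z z' => by rw [hA, hA, hsymm], fun z z' => ?_, fun z => ?_⟩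
  · have h1 := hc z z'
    rw [← hA, ← hH, hlam] at h1
    rw [h1]
    push_cast
    ring
  · obtain ⟨I, J, -, h1, -⟩ := hdiag z
    exact ⟨I, J, h1⟩

end HcpRigiditySplit

/-- **Registered helper stub of `stub_templateLatticeSplit` (Aux file 3): the rational Gram
pencil of a template lattice.** For the hcp template with `h²/a² ∉ ℚ` and a `ℤ`-module `N ⊆ ℝ³`
all of whose vectors have template lengths, there are a symmetric biadditive `A : N → N → ℚ` and
an additive layer index `λ : N →+ ℤ` with `⟨z, z'⟩ = a² A(z,z') + h² λ(z) λ(z')` on `N`, the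
diagonal values of `A` being in-layer template values `(I² + IJ + J²)/9`. [folklore] -/
theorem stub_templateLatticeSplit_forms : ∀ (a h : ℝ) (ha : a ≠ 0) (hh : h ≠ 0), ¬ (∃ q : ℚ, h ^ 2 = (q : ℝ) * a ^ 2) → ∀ N : Submodule ℤ (EuclideanSpace ℝ (Fin 3)), (∀ z ∈ N, ∃ a' ∈ (Literature.MathematicalPhysics.StatisticalMechanics.hcpPeriodicConfiguration ha hh).points, ∃ b' ∈ (Literature.MathematicalPhysics.StatisticalMechanics.hcpPeriodicConfiguration ha hh).points, ‖z‖ = dist a' b') → ∃ (A : ↥N →+ ↥N →+ ℚ) (lam : ↥N →+ ℤ), (∀ z z' : ↥N, A z z' = A z' z) ∧ (∀ z z' : ↥N, inner ℝ (z : EuclideanSpace ℝ (Fin 3)) (z' : EuclideanSpace ℝ (Fin 3)) = a ^ 2 * ((A z z' : ℚ) : ℝ) + h ^ 2 * ((lam z : ℤ) : ℝ) * ((lam z' : ℤ) : ℝ)) ∧ (∀ z : ↥N, ∃ I J : ℤ, A z z = ((I : ℚ) ^ 2 + I * J + J ^ 2) / 9) :=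
  fun _ _ ha hh hq _ hN =>
    HcpRigiditySplit.exists_forms ha hq (HcpRigiditySplit.normSq_decomp_of_template ha hh hN)

end Summit.AtomisticToContinuum.Crystallization.Theorems
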